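import Summits.BirchSwinnertonDyer.BirchSwinnertonDyer.Theorems.ByReductionTypeAtTwoSupersingularFlatLocalDualityMap
import HarnessLib

/-!
# Route `ByReductionTypeAtTwo` (rung K4), crux `SupersingularRankZeroAtTwo` (item stmt-BirchSwinnertonDyer-19097), line
# `odd_blind_package` v2.16, stub 3/6 `stub_flatPackage`, conjunct (8), clause F1♭ — **THE ♭ LOCAL DUALITY MAP DESCENDED TO
# `Λ ≅ H¹_Iw(K_v,T)/Ker Col♭`: `ν̄ : Λ →+ X♭`, `ν̄(Col♭ w) = ν w`**, with its values, its vanishing on `Sel₀` (`δ ∘ ν̄ = 0` for the tree's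
# transpose `δ : X♭ ↠ X₀`), and its variance **`(1 + X) • ν̄((1 + X) • f) = ν̄ f`** (cell `bsd-2adic`, seat `bsd-2adic-tower-1` GEN 67,
# hand H2-F1F3; sequel of `…FlatLocalDualityMap` (p830536); `--supports 19097`, helper)

HONEST FRAMING (D-0054): THEOREMS ONLY — no definition, no named fact, no instance, no `sorry`.  Generic (any number field, prime,
`ℤ_p`-extension, place, generator pair, `p ∣ a_p`, any Λ-LINEAR ♭ Coleman family `J` with `Col♭ = (J ·).2` ONTO `Λ`, any pin `D`).

`ν̄` is the `P := ⊤ ⊆ Λ` candidate for the `toX` of conjunct (8): by (K) of `exists_flatLocalDualityHom` the map `ν` factors through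
`Col♭`, and `Col♭` is onto (`SSFlatEC.flat_surjective_rat` on the habitat).  The variance clause says `ν̄` is `ι`-SEMILINEAR
(`ι(T) = (1+T)⁻¹ − 1`) for the standard `Λ`-structure of `Λ` and the pinned structure of `D.X` — the kernel-certified form of the convention
finding of `HOME/tower/gen67/F3-ERL-flat-at-2.md` §4: composing with `ι` (or twisting a pin) is needed before `ν̄` can serve as a
`Λ`-LINEAR `toX`.  `half-exactness`: `δ (ν̄ f) = 0` for every `f` (range `ν̄ ⊆ ker δ`); the converse inclusion and `ker ν̄ = Col♭(loc 𝐇¹)`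
(Poitou–Tate) are NOT here.  Closes NO stub; 19097 OPEN; nothing booked; BSD is proved for no curve; typed ≠ proved.

References: [Kobayashi2003] (7.17)–(7.21) (p. 12); [Sprung2012] Def. 7.9, 7.11 (p. 1503), Prop. 7.3 (p. 1500), Prop. 7.19 (p. 1505);
[GreenbergLNM1716] §1 p. 60; [KitajimaOtsuki2018] (4.2), Prop. 3.32.
-/

set_option autoImplicit false
-- the Theorems namespace of this sub repeats the summit name by design (D-0017 nested layout)
set_option linter.dupNamespace false

noncomputable section

open scoped Classical NumberField

universe u

namespace Summit.BirchSwinnertonDyer.BirchSwinnertonDyer.Theorems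

namespace SSFlatPackage

open NumberField IsDedekindDomain Field WeierstrassCurve Literature.NumberTheory.EllipticCurves
  Literature.NumberTheory.EllipticCurves.Sprung2012 Literature.NumberTheory.EllipticCurves.Sprung2017
  Literature.NumberTheory.EllipticCurves.Kobayashi2003 Literature.NumberTheory.EllipticCurves.IwasawaDual
  Literature.NumberTheory.EllipticCurves.GreenbergSelmer Literature.NumberTheory.GaloisRepresentations
  Literature.Algebra.Module ZpExtension

variable {K : Type u} [Field K] [NumberField K] (W : WeierstrassCurve K) [W.IsElliptic] {p : ℕ} [hp : Fact p.Prime]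
  (κ : ZpExtension K p) {γ : absoluteGaloisGroup K} (v : HeightOneSpectrum (𝓞 K)) {ap : ℤ}
  {g : absoluteGaloisGroup (v.adicCompletion K)} {c : ℕ → localPoints W (v.adicCompletion K)}

/-- A transpose `kk : X♭ → X₀` of `Sel₀ ≤ Sel♭` kills every `x ∈ X♭` whose character vanishes on `Sel₀` (`Y.toDual` is injective).
[cite: Sprung2012, Prop. 7.19 (p. 1505)] [cite: GreenbergLNM1716, §1 p. 60] -/
theorem transpose_eq_zero_of_toDual_fineSelmer_eq_zero
    (D : SharpFlatSelmerDualData W κ γ (closureEmb (K := K) (v.adicCompletion K)) ap g c .flat)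
    (Y : W.FineSelmerDualData κ γ) (kk : D.X →+ Y.X)
    (hkk : ∀ (x : D.X) (s : W.fineSelmerInfty κ),
      Y.toDual (kk x) s = D.toDual x (AddSubgroup.inclusion (fineSelmerInfty_le_sharpFlatSelmerInfty W κ v ap g c .flat) s))
    (x : D.X)
    (hx : ∀ s : sharpFlatSelmerInfty W κ (closureEmb (K := K) (v.adicCompletion K)) ap g c .flat,
      (s : W.subgroupH1 p κ.kerSubgroup) ∈ W.fineSelmerInfty κ → D.toDual x s = 0) :
    kk x = 0 := by
  apply Y.bijective.1
  rw [map_zero]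
  refine AddMonoidHom.ext fun s ↦ ?_
  rw [hkk, AddMonoidHom.zero_apply]
  -- the membership of the included class, WITHOUT asking the kernel to compare the two carriers
  have hs : ((AddSubgroup.inclusion (fineSelmerInfty_le_sharpFlatSelmerInfty W κ v ap g c .flat) s :
      sharpFlatSelmerInfty W κ (closureEmb (K := K) (v.adicCompletion K)) ap g c .flat) :
        W.subgroupH1 p κ.kerSubgroup) ∈ W.fineSelmerInfty κ := by
    rw [AddSubgroup.coe_inclusion]
    exact s.2
  exact hx _ hs

/-- ★ **`ν̄ : Λ →+ X♭`, the ♭ local duality map on `Λ ≅ H¹_Iw(K_v,T)/Ker Col♭`.**  For a Λ-LINEAR ♭ Coleman family `J` (`Col(z) = J z`,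
structure `moduleOfGenerator`) whose ♭ component is ONTO `Λ`, and a pinned ♭ dual datum `D`: there is an additive `ν̄ : Λ →+ D.X` with
(V̄) `D.toDual (ν̄ (J w).2) s = w(p^kQ)/p^k mod ℤ` for every functional `w` and Kummer datum `(φ, Q, k)` of `s ∈ Sel♭` at `v` (well defined:
`Ker Col♭ ⊆ ker ν`); (Z̄) `ν̄ f` kills `Sel₀(K_∞, E[p^∞])`; (δ̄) hence `k (ν̄ f) = 0` for every additive `k : D.X → Y.X` transposing `Sel₀ ≤ Sel♭`
(e.g. the Λ-linear surjection of `SharpFlatSelmerDualData.exists_linearMap_toFineDual`); (T̄) `(1 + X) • ν̄ ((1 + X) • f) = ν̄ f` — `ν̄` is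
`ι`-semilinear, not `Λ`-linear. [cite: Kobayashi2003, (7.17)–(7.21) (p. 12)] [cite: Sprung2012, Def. 7.9, Def. 7.11 (p. 1503), Prop. 7.19 (p. 1505)]
[cite: GreenbergLNM1716, §1 p. 60] -/
theorem exists_flatLocalDualityHom_lambda (hγ : κ.IsTopGenerator γ)
    (hg : κ.IsTopGenerator (resGalOfEmb (closureEmb (K := K) (v.adicCompletion K)) g)) (hap : (p : ℤ) ∣ ap)
    (J : letI := moduleOfGenerator κ (closureEmb (K := K) (v.adicCompletion K)) W hg
      (localTowerPointsOfEmb κ (closureEmb (K := K) (v.adicCompletion K)) W →+ ℤ_[p]) →ₗ[IwasawaAlgebra p]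
        IwasawaAlgebra p × IwasawaAlgebra p)
    (hJ : ∀ z, IsColemanPair κ (closureEmb (K := K) (v.adicCompletion K)) W ap g c z (J z).1 (J z).2)
    (hsurj : ∀ f : IwasawaAlgebra p, ∃ w, (J w).2 = f)
    (D : SharpFlatSelmerDualData W κ γ (closureEmb (K := K) (v.adicCompletion K)) ap g c .flat) :
    ∃ νΛ : IwasawaAlgebra p →+ D.X,
      (∀ (w : localTowerPointsOfEmb κ (closureEmb (K := K) (v.adicCompletion K)) W →+ ℤ_[p])
          (s : sharpFlatSelmerInfty W κ (closureEmb (K := K) (v.adicCompletion K)) ap g c .flat)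
          (φ : contOneCocycles.{0, u} (discreteTopRep κ.kerSubgroup (W.geomPrimaryTorsion p)))
          (Q : localPoints W (v.adicCompletion K)) (k : ℕ)
          (hQ : (p ^ k) • Q ∈ localTowerPointsOfEmb κ (closureEmb (K := K) (v.adicCompletion K)) W),
          oneCocycleClass (discreteTopRep κ.kerSubgroup (W.geomPrimaryTorsion p)) φ = (s : W.subgroupH1 p κ.kerSubgroup) →
          (∀ τ : localSubgroupOfEmb κ.kerSubgroup (closureEmb (K := K) (v.adicCompletion K)),
            pointsMapOfEmb W (closureEmb (K := K) (v.adicCompletion K))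
                ((φ.1 (resGalSubgroupOfEmb κ.kerSubgroup _ τ) : W.geomPrimaryTorsion p) : W.geomPoints) =
              (τ : absoluteGaloisGroup (v.adicCompletion K)) • Q - Q) →
          ∀ a : ℤ, PadicInt.toZModPow k (w ⟨(p ^ k) • Q, hQ⟩) = (a : ZMod (p ^ k)) →
            D.toDual (νΛ (J w).2) s = (((a : ℚ) / (p : ℚ) ^ k : ℚ) : AddCircle (1 : ℚ))) ∧
      (∀ (f : IwasawaAlgebra p) (s : sharpFlatSelmerInfty W κ (closureEmb (K := K) (v.adicCompletion K)) ap g c .flat),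
          (s : W.subgroupH1 p κ.kerSubgroup) ∈ W.fineSelmerInfty κ → D.toDual (νΛ f) s = 0) ∧
      (∀ (Y : W.FineSelmerDualData κ γ) (kk : D.X →+ Y.X),
          (∀ (x : D.X) (s : W.fineSelmerInfty κ),
            Y.toDual (kk x) s = D.toDual x (AddSubgroup.inclusion (fineSelmerInfty_le_sharpFlatSelmerInfty W κ v ap g c .flat) s)) →
          ∀ f, kk (νΛ f) = 0) ∧
      (∀ f : IwasawaAlgebra p,
        (1 + PowerSeries.X : IwasawaAlgebra p) • νΛ ((1 + PowerSeries.X : IwasawaAlgebra p) • f) = νΛ f) := by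
  letI inst := moduleOfGenerator κ (closureEmb (K := K) (v.adicCompletion K)) W hg
  obtain ⟨ν, hV, hK, hZ, hT⟩ := exists_flatLocalDualityHom W κ v hγ hg hap (fun z ↦ J z) (Js := fun z ↦ (J z).1) hJ D
  -- `ν` is constant on the fibres of `Col♭`
  have hwd : ∀ w w', (J w).2 = (J w').2 → ν w = ν w' := by
    intro w w' h
    rw [← sub_eq_zero, ← map_sub]
    exact hK _ (by rw [map_sub, Prod.snd_sub, h, sub_self])
  choose lift hlift using hsurj
  let νΛ : IwasawaAlgebra p →+ D.X :=
    { toFun := fun f ↦ ν (lift f)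
      map_zero' := by
        have h := hwd (lift 0) 0 (by rw [hlift, map_zero, Prod.snd_zero])
        rw [h, map_zero]
      map_add' := fun f f' ↦ by
        have h := hwd (lift (f + f')) (lift f + lift f') (by rw [hlift, map_add, Prod.snd_add, hlift, hlift])
        rw [h, map_add] }
  have hνΛ : ∀ w, νΛ (J w).2 = ν w := fun w ↦ hwd _ _ (hlift _)
  refine ⟨νΛ, fun w s φ Q k hQ hφ hτ a ha ↦ by rw [hνΛ]; exact hV w s φ Q k hQ hφ hτ a ha, fun f s hs ↦ hZ (lift f) s hs,
    fun Y kk hkk f ↦ transpose_eq_zero_of_toDual_fineSelmer_eq_zero W κ v D Y kk hkk (νΛ f) fun s hs ↦ hZ (lift f) s hs,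
    fun f ↦ ?_⟩
  · -- (T̄) variance through a lift: `Col♭((1+T) • lift f) = (1+T) • f`
    have h1 : (J ((1 + PowerSeries.X : IwasawaAlgebra p) • lift f)).2 = (1 + PowerSeries.X : IwasawaAlgebra p) • f := by
      rw [map_smul, Prod.smul_snd, hlift]
    have key : νΛ ((1 + PowerSeries.X : IwasawaAlgebra p) • f) = ν ((1 + PowerSeries.X : IwasawaAlgebra p) • lift f) :=
      hwd _ _ (by rw [hlift, h1])
    have key' : νΛ f = ν (lift f) := rfl
    rw [key, key']
    exact hT (lift f)

end SSFlatPackage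

end Summit.BirchSwinnertonDyer.BirchSwinnertonDyer.Theorems

end
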